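import Summits.AnomalousDissipation.AnomalousDissipation.Theorems.EnsembleRigidityDefs
import Summits.AnomalousDissipation.AnomalousDissipation.Theorems.TaylorCertificatesZeroDatumLerayHopf
import Summits.AnomalousDissipation.AnomalousDissipation.Theorems.TaylorCertificatesSteadyStatesLoudBoundedStubGpAdmissible
import Literature.Analysis.FluidPDE.NSHopfWeakConvergence
import Literature.Analysis.FluidPDE.NSHopfGalerkinLimit
import Literature.Analysis.FunctionSpaces.TorusAxisAverage

/-!
# Crux `EnsembleRigidity.GPMeanBoundedFamily` (stmt-AnomalousDissipation-15509), line `Sketch`: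
  stub `stub_symmetricLimit` — the `G`-symmetric Leray–Hopf limit of a `G`-symmetric scheme

Pattern `NSHopfInvariant` (`exists_invariant_limitField`, `hopf_galerkin_limit_invariant_holds`) re-done for the
finite stabiliser `G` (order 24) of `f_GP`: the limit field `u` of `IsHopfGalerkinScheme.exists_limitField` is the weak
`L²` limit of the approximants at every `t ≥ 0` (`IsHopfGalerkinScheme.tendsto_integral_inner_limit`), so every
covariance `U n t (A y) = L (U n t y)` (`A` volume preserving, `L` a signed coordinate permutation) passes to `u t`
a.e. (`ae_symm_of_tendsto`); the `L²` class of `u t` is represented by its `G`-average — the iterated average over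
`⟨ι⟩ · ⟨c⟩ · V`, `V = {1, τ, τ', ττ'}`, `τ' = cτc²` (relations `τ² = 1`, `ττ' = τ'τ`, `c²τc = ττ'`, `ιτ = τι` from
`2 · ½ = 0` in `ℝ/ℤ`) — which is `G`-symmetric at every point with measurable space–time lift, so that
`IsHopfGalerkinScheme.isLerayHopfOn_limit` applies; the `H`-lift is `exists_energySpace_lift_of_isGlobalLerayHopf_zero`.
References: Hopf 1951, §4; Robinson–Rodrigo–Sadowski 2016, Thm. 4.4 Steps 3–4, (4.12).
-/

noncomputable section

-- every `Summit.AnomalousDissipation.AnomalousDissipation.…` name repeats the summit = sub-problem segment (D-0017 layout)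
set_option linter.dupNamespace false

namespace Summit.AnomalousDissipation.AnomalousDissipation.Theorems.EnsembleRigidity.GPMeanBoundedFamily

open MeasureTheory Filter Topology Set Function
open scoped InnerProductSpace RealInnerProductSpace ENNReal
open Literature.Analysis.FunctionSpaces Literature.Analysis.FluidPDE
open Summit.AnomalousDissipation.AnomalousDissipation.Theorems.EnsembleRigidity

/-- Local notation for the flat unit torus `𝕋 = UnitAddTorus (Fin 3)`. -/
local notation "𝕋" => UnitAddTorus (Fin 3)

/-- Local notation for physical space `E3 = EuclideanSpace ℝ (Fin 3)`. -/
local notation "E3" => EuclideanSpace ℝ (Fin 3)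

namespace StubSymmetricLimit

/-- `2 · ½ = 0` in `ℝ/ℤ`. [folklore] -/
theorem halfPeriod_add_halfPeriod : halfPeriod + halfPeriod = 0 := by
  unfold halfPeriod; rw [← AddCircle.coe_add]; norm_num

/-- `-½ = ½` in `ℝ/ℤ`. [folklore] -/
theorem neg_halfPeriod : -halfPeriod = halfPeriod := neg_eq_of_add_eq_zero_left halfPeriod_add_halfPeriod

/-- `c³ = 1`. [folklore] -/
theorem cycShift_three (y : 𝕋) : cycShift (cycShift (cycShift y)) = y := by
  funext j; simp only [cycShift, (by decide : ∀ j : Fin 3, j + 1 + 1 + 1 = j)]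

/-- `τ² = 1`. [folklore] -/
theorem twistTurn_twistTurn (y : 𝕋) : twistTurn (twistTurn y) = y := by
  funext j; fin_cases j <;> simp [twistTurn, add_assoc, halfPeriod_add_halfPeriod]

/-- `ι τ = τ ι`. [folklore] -/
theorem neg_twistTurn (y : 𝕋) : -twistTurn y = twistTurn (-y) := by
  funext j; fin_cases j <;> simp [twistTurn, neg_halfPeriod, add_comm]

/-- `τ τ' = τ' τ` for `τ' = c τ c²` (the Klein relations of `V`). [folklore] -/
theorem twistTurn_comm (y : 𝕋) : twistTurn (cycShift (twistTurn (cycShift (cycShift y)))) =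
    cycShift (twistTurn (cycShift (cycShift (twistTurn y)))) := by
  funext j; fin_cases j <;> simp [twistTurn, cycShift, neg_halfPeriod, add_comm]

/-- `c² τ c = τ τ'`: conjugation by `c` permutes the three twisted half-turns of `V`. [folklore] -/
theorem twistTurn_conj (y : 𝕋) : cycShift (cycShift (twistTurn (cycShift y))) =
    twistTurn (cycShift (twistTurn (cycShift (cycShift y)))) := by
  funext j; fin_cases j
  · simp [twistTurn, cycShift]
  · simp [twistTurn, cycShift, neg_halfPeriod, add_comm]
  · simp [twistTurn, cycShift, neg_halfPeriod]
    rw [add_comm halfPeriod, add_assoc, halfPeriod_add_halfPeriod, add_zero]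

/-- `τ'² = 1`. [folklore] -/
theorem twistTurn'_twistTurn' (y : 𝕋) :
    cycShift (twistTurn (cycShift (cycShift (cycShift (twistTurn (cycShift (cycShift y))))))) = y := by
  rw [cycShift_three, twistTurn_twistTurn, cycShift_three]

/-- The coordinate 3-cycle preserves the volume of `T³`. [folklore] -/
theorem measurePreserving_cycShift : MeasurePreserving cycShift (volume : Measure 𝕋) volume := by
  have h := volume_measurePreserving_piCongrLeft (fun _ : Fin 3 => UnitAddCircle) (Equiv.addRight (1 : Fin 3)).symm
  have heq : (⇑(MeasurableEquiv.piCongrLeft (fun _ : Fin 3 => UnitAddCircle) (Equiv.addRight (1 : Fin 3)).symm) :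
      𝕋 → 𝕋) = cycShift := by
    funext g j; simp [MeasurableEquiv.coe_piCongrLeft, Equiv.piCongrLeft_apply_eq_cast, cycShift]
  rwa [heq] at h

/-- The inversion preserves the volume of `T³`. [folklore] -/
theorem measurePreserving_neg_torus : MeasurePreserving (Neg.neg : 𝕋 → 𝕋) volume volume :=
  haveI : (volume : Measure 𝕋).IsNegInvariant := Measure.pi.isNegInvariant _
  Measure.measurePreserving_neg _

/-- The twisted half-turn preserves the volume of `T³` (coordinatewise maps of `ℝ/ℤ`). [folklore] -/
theorem measurePreserving_twistTurn : MeasurePreserving twistTurn (volume : Measure 𝕋) volume := by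
  have h0 : MeasurePreserving (fun a : UnitAddCircle => a + halfPeriod) volume volume :=
    measurePreserving_add_right volume halfPeriod
  have h1 : MeasurePreserving (Neg.neg : UnitAddCircle → UnitAddCircle) volume volume := Measure.measurePreserving_neg _
  have h := volume_preserving_pi (α' := fun _ : Fin 3 => UnitAddCircle) (β' := fun _ => UnitAddCircle)
    (f := ![fun a => a + halfPeriod, Neg.neg, fun a => -a + halfPeriod]) (by
      intro i; fin_cases i; exacts [h0, h1, h0.comp h1])
  have heq : (fun (a : 𝕋) (i : Fin 3) => (![fun a => a + halfPeriod, Neg.neg, fun a => -a + halfPeriod] :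
      Fin 3 → UnitAddCircle → UnitAddCircle) i (a i)) = twistTurn := by
    funext y i; fin_cases i <;> rfl
  rwa [heq] at h

/-- `τ' = c τ c²` preserves the volume of `T³`. [folklore] -/
theorem measurePreserving_twistTurn' :
    MeasurePreserving (fun y : 𝕋 => cycShift (twistTurn (cycShift (cycShift y)))) volume volume :=
  measurePreserving_cycShift.comp (measurePreserving_twistTurn.comp
    (measurePreserving_cycShift.comp measurePreserving_cycShift))

/-- The signed coordinate shift `a ↦ (sᵢ a_{i+j})ᵢ` as a continuous linear map of `ℝ³`. [folklore] -/
theorem exists_signedShift (s : Fin 3 → ℝ) (j : Fin 3) :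
    ∃ L : E3 →L[ℝ] E3, ∀ (a : E3) (i : Fin 3), L a i = s i * a (i + j) := by
  refine ⟨LinearMap.toContinuousLinearMap
    (IsLinearMap.mk' (fun a : E3 => (WithLp.toLp 2 (fun i => s i * a (i + j)) : E3)) ⟨?_, ?_⟩), ?_⟩
  · intro a b; ext i; simp [mul_add]
  · intro c a; ext i; simp [mul_left_comm]
  · intro a i; simp

/-- The twisted half-turn clause of `IsGPSymmetric` in sign form `u (τ y) = diag(1,−1,−1) u y`. [folklore] -/
theorem twist_clause_iff (u : 𝕋 → E3) (y : 𝕋) :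
    (u (twistTurn y) 0 = u y 0 ∧ u (twistTurn y) 1 = -(u y 1) ∧ u (twistTurn y) 2 = -(u y 2)) ↔
      ∀ i, u (twistTurn y) i = (![(1 : ℝ), -1, -1] : Fin 3 → ℝ) i * u y i := by
  refine ⟨fun ⟨h0, h1, h2⟩ i => ?_, fun h => ⟨by simpa using h 0, by simpa using h 1, by simpa using h 2⟩⟩
  fin_cases i
  exacts [by simp [h0], by simp [h1], by simp [h2]]

/-- **Components of weak `L²` limits inherit the signed covariance of the approximants.** If `v n ⇀ w` weakly in
`L²(T³; ℝ³)`, `A` is a volume-preserving self-map of `T³` with a volume-preserving left inverse `B`, and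
`(v n (A y))ᵢ = c (v n y)ⱼ` for all `n`, `y`, then `(w (A y))ᵢ = c (w y)ⱼ` for a.e. `y`: the defect is the weak limit
of `0` (change of variables, uniqueness of limits) and is tested against itself. [folklore] -/
theorem ae_symm_of_tendsto {A B : 𝕋 → 𝕋} (hA : MeasurePreserving A volume volume)
    (hB : MeasurePreserving B volume volume) (hBA : ∀ y, B (A y) = y)
    {v : ℕ → 𝕋 → E3} {w : 𝕋 → E3} (hv : ∀ n, MemLp (v n) 2 volume) (hw : MemLp w 2 volume)
    (hweak : ∀ a : 𝕋 → E3, MemLp a 2 volume →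
      Tendsto (fun n => ∫ y, ⟪v n y, a y⟫) atTop (𝓝 (∫ y, ⟪w y, a y⟫)))
    {i j : Fin 3} {c : ℝ} (hsym : ∀ n y, v n (A y) i = c * v n y j) :
    ∀ᵐ y ∂volume, w (A y) i = c * w y j := by
  -- scalar components are in `L²`
  have hcomp : ∀ {g : 𝕋 → E3}, MemLp g 2 volume → ∀ k, MemLp (fun y => g y k) 2 volume :=
    fun hg k => (EuclideanSpace.proj k : E3 →L[ℝ] ℝ).comp_memLp' hg
  -- pairing against `φ • e_k` picks the `k`-th component
  have hweak' : ∀ (φ : 𝕋 → ℝ), MemLp φ 2 volume → ∀ k,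
      Tendsto (fun n => ∫ y, v n y k * φ y) atTop (𝓝 (∫ y, w y k * φ y)) := by
    intro φ hφ k
    have hpair : ∀ g : 𝕋 → E3, (∫ y, ⟪g y, φ y • EuclideanSpace.single k (1 : ℝ)⟫) = ∫ y, g y k * φ y :=
      fun g => integral_congr_ae (ae_of_all _ fun y => by
        simp [real_inner_smul_right, EuclideanSpace.inner_single_right, mul_comm])
    have ha : MemLp (fun y => φ y • EuclideanSpace.single k (1 : ℝ)) 2 volume := (memLp_top_const _).smul hφ
    simpa only [hpair] using hweak _ ha
  -- change of variables `y ↦ A y` against a test function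
  have hcv : ∀ {g : 𝕋 → E3}, MemLp g 2 volume → ∀ {φ : 𝕋 → ℝ}, MemLp φ 2 volume → ∀ k,
      ∫ y, g (A y) k * φ y = ∫ y, g y k * φ (B y) := by
    intro g hg φ hφ k
    have hG : AEStronglyMeasurable (fun z => g z k * φ (B z)) (Measure.map A volume) := by
      rw [hA.map_eq]; exact (hcomp hg k).1.mul (hφ.comp_measurePreserving hB).1
    have heq : (fun y => g (A y) k * φ y) = fun y => (fun z => g z k * φ (B z)) (A y) := by
      funext y; simp only [hBA]
    rw [heq, ← integral_map hA.measurable.aemeasurable hG, hA.map_eq]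
  -- the defect `y ↦ (w (A y))ᵢ - c (w y)ⱼ` is orthogonal to `L²`
  have horth : ∀ φ : 𝕋 → ℝ, MemLp φ 2 volume → ∫ y, (w (A y) i - c * w y j) * φ y = 0 := by
    intro φ hφ
    have h1 : Tendsto (fun n => ∫ y, v n y i * φ (B y)) atTop (𝓝 (∫ y, w y i * φ (B y))) :=
      hweak' _ (hφ.comp_measurePreserving hB) i
    have h2 : Tendsto (fun n => ∫ y, v n y i * φ (B y)) atTop (𝓝 (c * ∫ y, w y j * φ y)) := by
      refine ((hweak' φ hφ j).const_mul c).congr fun n => ?_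
      rw [← hcv (hv n) hφ i, ← integral_const_mul]
      exact integral_congr_ae (ae_of_all _ fun y => by simp only [hsym n y, mul_assoc])
    have hint1 : Integrable (fun y => w (A y) i * φ y) volume :=
      ((hcomp hw i).comp_measurePreserving hA).integrable_mul hφ
    have hint2 : Integrable (fun y => c * w y j * φ y) volume := (((hcomp hw j).integrable_mul hφ).const_mul c).congr
      (ae_of_all _ fun y => by simp only [Pi.mul_apply, mul_assoc])
    simp_rw [sub_mul]
    rw [integral_sub hint1 hint2, hcv hw hφ i, tendsto_nhds_unique h1 h2, sub_eq_zero]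
    simp_rw [mul_assoc]; exact (integral_const_mul c _).symm
  -- test against the defect itself
  have hF2 : MemLp (fun y => w (A y) i - c * w y j) 2 volume :=
    ((hcomp hw i).comp_measurePreserving hA).sub ((hcomp hw j).const_mul c)
  have hsq : ∫ y, (w (A y) i - c * w y j) ^ 2 = 0 := by simpa only [sq] using horth _ hF2
  have hae := (integral_eq_zero_iff_of_nonneg (fun y => sq_nonneg _) hF2.integrable_sq).1 hsq
  filter_upwards [hae] with y hy
  exact sub_eq_zero.1 (pow_eq_zero_iff two_ne_zero |>.1 hy)

/-- Transport of an a.e. covariance relation along an a.e. equality (`A` volume preserving). [folklore] -/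
theorem ae_transport {A : 𝕋 → 𝕋} (hA : MeasurePreserving A volume volume) {v w : 𝕋 → E3}
    (hwv : w =ᵐ[volume] v) (p : E3 → E3 → Prop) (h : ∀ᵐ y ∂volume, p (v (A y)) (v y)) :
    ∀ᵐ y ∂volume, p (w (A y)) (w y) := by
  filter_upwards [hwv, hA.quasiMeasurePreserving.ae_eq_comp hwv, h] with y h1 h2 h3
  simp only [Function.comp_apply] at h2; rwa [h2, h1]

section Avg2

variable {A : 𝕋 → 𝕋} {s : Fin 3 → ℝ} {D : E3 → E3} {v w : 𝕋 → E3}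

/-- The average `w = ½(v + D v∘A)` over an involution `A` with involutive signs `D` is `A`-covariant. [folklore] -/
theorem avg2_symm (hAA : ∀ y, A (A y) = y) (hs : ∀ i, s i * s i = 1) (hD : ∀ a i, D a i = s i * a i)
    (hw : ∀ y, w y = (1 / 2 : ℝ) • (v y + D (v (A y)))) : ∀ y i, w (A y) i = s i * w y i := by
  intro y i; rw [hw, hw]; simp only [PiLp.smul_apply, PiLp.add_apply, hD, hAA, smul_eq_mul]
  linear_combination (-(1 / 2 : ℝ) * v (A y) i) * hs i

/-- If `v` is already a.e. `A`-covariant, the average agrees with `v` a.e. [folklore] -/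
theorem avg2_ae_eq (hs : ∀ i, s i * s i = 1) (hD : ∀ a i, D a i = s i * a i)
    (hw : ∀ y, w y = (1 / 2 : ℝ) • (v y + D (v (A y)))) (hv : ∀ᵐ y ∂volume, ∀ i, v (A y) i = s i * v y i) :
    w =ᵐ[volume] v := by
  filter_upwards [hv] with y hy
  ext i; rw [hw]; simp only [PiLp.smul_apply, PiLp.add_apply, hD, hy i, smul_eq_mul]
  linear_combination ((1 / 2 : ℝ) * v y i) * hs i

/-- The average over `A` keeps a pointwise diagonal covariance under a map `B` commuting with `A`. [folklore] -/
theorem avg2_keeps_diag {B : 𝕋 → 𝕋} {s' : Fin 3 → ℝ} (hAB : ∀ y, A (B y) = B (A y))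
    (hD : ∀ a i, D a i = s i * a i) (hw : ∀ y, w y = (1 / 2 : ℝ) • (v y + D (v (A y))))
    (hvB : ∀ y i, v (B y) i = s' i * v y i) : ∀ y i, w (B y) i = s' i * w y i := by
  intro y i; rw [hw, hw]; simp only [PiLp.smul_apply, PiLp.add_apply, hD, hAB, hvB, smul_eq_mul]; ring

/-- The average over `A` with a scalar sign keeps the cyclic covariance under `B` commuting with `A`. [folklore] -/
theorem avg2_keeps_cyc {B : 𝕋 → 𝕋} {c : ℝ} (hAB : ∀ y, A (B y) = B (A y)) (hD : ∀ a i, D a i = c * a i)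
    (hw : ∀ y, w y = (1 / 2 : ℝ) • (v y + D (v (A y)))) (hvB : ∀ y i, v (B y) i = v y (i + 1)) :
    ∀ y i, w (B y) i = w y (i + 1) := by
  intro y i; rw [hw, hw]; simp only [PiLp.smul_apply, PiLp.add_apply, hD, hAB, hvB, smul_eq_mul]

end Avg2

section Avg3

variable {C : 𝕋 → 𝕋} {P₁ P₂ : E3 → E3} {v w : 𝕋 → E3}

/-- The average `w = ⅓(v + P² v∘c + P v∘c²)` over the 3-cycle is `c`-covariant at every point. [folklore] -/
theorem avg3_symm (hC3 : ∀ y, C (C (C y)) = y) (hP₁ : ∀ a i, P₁ a i = a (i + 1)) (hP₂ : ∀ a i, P₂ a i = a (i + 2))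
    (hw : ∀ y, w y = (1 / 3 : ℝ) • (v y + P₂ (v (C y)) + P₁ (v (C (C y))))) : ∀ y i, w (C y) i = w y (i + 1) := by
  intro y i; rw [hw, hw]
  simp only [PiLp.smul_apply, PiLp.add_apply, hP₁, hP₂, hC3, (by decide : ∀ i : Fin 3, i + 1 + 2 = i),
    (by decide : ∀ i : Fin 3, i + 1 + 1 = i + 2), smul_eq_mul]; ring

/-- If `v` is already a.e. `c`-covariant, the average over the 3-cycle agrees with `v` a.e. [folklore] -/
theorem avg3_ae_eq (hP₁ : ∀ a i, P₁ a i = a (i + 1)) (hP₂ : ∀ a i, P₂ a i = a (i + 2))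
    (hw : ∀ y, w y = (1 / 3 : ℝ) • (v y + P₂ (v (C y)) + P₁ (v (C (C y)))))
    (hv1 : ∀ᵐ y ∂volume, ∀ i, v (C y) i = v y (i + 1))
    (hv2 : ∀ᵐ y ∂volume, ∀ i, v (C (C y)) i = v (C y) (i + 1)) : w =ᵐ[volume] v := by
  filter_upwards [hv1, hv2] with y hy1 hy2
  ext i; rw [hw]
  simp only [PiLp.smul_apply, PiLp.add_apply, hP₁, hP₂, hy2, hy1, (by decide : ∀ i : Fin 3, i + 2 + 1 = i),
    (by decide : ∀ i : Fin 3, i + 1 + 1 + 1 = i), smul_eq_mul]; ring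

/-- The average over the 3-cycle keeps a diagonal covariance under `T` provided `v` is covariant under the three
conjugates `T`, `c T c²`, `c² T c` (signs cyclically shifted). [folklore] -/
theorem avg3_keeps_diag {T : 𝕋 → 𝕋} {s : Fin 3 → ℝ} (hC3 : ∀ y, C (C (C y)) = y)
    (hP₁ : ∀ a i, P₁ a i = a (i + 1)) (hP₂ : ∀ a i, P₂ a i = a (i + 2))
    (hw : ∀ y, w y = (1 / 3 : ℝ) • (v y + P₂ (v (C y)) + P₁ (v (C (C y))))) (hT : ∀ y i, v (T y) i = s i * v y i)
    (hT' : ∀ y i, v (C (T (C (C y)))) i = s (i + 1) * v y i) (hT'' : ∀ y i, v (C (C (T (C y)))) i = s (i + 2) * v y i) :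
    ∀ y i, w (T y) i = s i * w y i := by
  have k1 : ∀ y i, v (C (T y)) i = s (i + 1) * v (C y) i := fun y i => by simpa only [hC3] using hT' (C y) i
  have k2 : ∀ y i, v (C (C (T y))) i = s (i + 2) * v (C (C y)) i := fun y i => by
    simpa only [hC3] using hT'' (C (C y)) i
  intro y i; rw [hw, hw]
  simp only [PiLp.smul_apply, PiLp.add_apply, hP₁, hP₂, hT, k1, k2, (by decide : ∀ i : Fin 3, i + 2 + 1 = i),
    (by decide : ∀ i : Fin 3, i + 1 + 2 = i), smul_eq_mul]; ring

end Avg3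

/-- `(t, y) ↦ L (u t (A y))` is jointly a.e. strongly measurable when `uncurry u` is (`A` volume preserving,
`L` continuous linear). [folklore] -/
theorem aestronglyMeasurable_uncurry_comp {S : Set ℝ} {u : ℝ → 𝕋 → E3}
    (hu : AEStronglyMeasurable (uncurry u) ((volume.restrict S).prod volume))
    {A : 𝕋 → 𝕋} (hA : MeasurePreserving A volume volume) (L : E3 →L[ℝ] E3) :
    AEStronglyMeasurable (uncurry fun t y => L (u t (A y))) ((volume.restrict S).prod volume) :=
  L.continuous.comp_aestronglyMeasurable (hu.comp_measurePreserving ((MeasurePreserving.id _).prod hA))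

end StubSymmetricLimit

open StubSymmetricLimit in
/-- **S6 `stub_symmetricLimit`**. A Hopf–Galerkin scheme for `(ν, f_GP, 0)` with `G`-symmetric approximants has a
global Leray–Hopf limit from rest with an `H`-valued lift (`U' t = u t` a.e., `t ≥ 0`) and `G`-symmetric slices: the
limit field of `IsHopfGalerkinScheme.exists_limitField` is a.e. covariant under the generators (`ae_symm_of_tendsto`,
weak `L²` limits at every `t ≥ 0`), its `L²` class is represented by its `G`-average, symmetric at every point and
with measurable space–time lift, to which `IsHopfGalerkinScheme.isLerayHopfOn_limit` applies; the lift is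
`exists_energySpace_lift_of_isGlobalLerayHopf_zero` (pattern `hopf_galerkin_limit_invariant_holds`; Hopf 1951, §4;
Robinson–Rodrigo–Sadowski 2016, Thm. 4.4 Steps 3–4). [folklore] -/
theorem stub_symmetricLimit :
    ∀ ν : ℝ, 0 < ν →
      ∀ (N : ℕ → ℕ) (F U : ℕ → ℝ → UnitAddTorus (Fin 3) → EuclideanSpace ℝ (Fin 3)),
        IsHopfGalerkinScheme ν (fun _ => gpForce) 0 N F U →
        (∀ n (t : ℝ), 0 ≤ t → IsGPSymmetric (U n t)) →
        ∃ (u : ℝ → UnitAddTorus (Fin 3) → EuclideanSpace ℝ (Fin 3))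
          (U' : ℝ → Torus.energySpace (Fin 3)),
          Torus.IsGlobalLerayHopf ν (fun _ => gpForce) 0 u ∧
          (∀ t, 0 ≤ t → ((U' t : Lp (EuclideanSpace ℝ (Fin 3)) 2
              (volume : Measure (UnitAddTorus (Fin 3)))) :
                UnitAddTorus (Fin 3) → EuclideanSpace ℝ (Fin 3)) =ᵐ[volume] u t) ∧
          ∀ t, 0 ≤ t → IsGPSymmetric (u t) := by
  intro ν hν N F U hS hUsym
  -- the force and the datum
  obtain ⟨hfs, -, hf0⟩ := SteadyStatesLoudBounded.GpAdmissible.stub_gpAdmissible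
  have hfm : AEStronglyMeasurable (Torus.stLift (fun _ : ℝ => gpForce)) (volume.restrict (Ioi 0 ×ˢ univ)) :=
    aestronglyMeasurable_stLift_const hfs _
  have hf₂ : ∀ T : ℝ, 0 < T → ∫⁻ _ in Ioo 0 T, ∫⁻ x, ‖gpForce x‖ₑ ^ 2 < ⊤ := fun T _ => lintegral_enorm_sq_const_lt_top hfs T
  have hu₀ : MemLp (0 : 𝕋 → E3) 2 volume := MemLp.zero
  have hdiv0 : Torus.IsWeaklyDivFree (0 : 𝕋 → E3) := fun θ _ => by simp
  -- the limit field: weak `L²` limit of the approximants at every `t ≥ 0`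
  obtain ⟨φ, hφ, u, hum, hu, hc⟩ := hS.exists_limitField hν.le hu₀ hfm hf₂
  have hS' := hS.comp_strictMono hφ
  have hweak : ∀ t, 0 ≤ t → ∀ a : 𝕋 → E3, MemLp a 2 volume →
      Tendsto (fun n => ∫ y, ⟪U (φ n) t y, a y⟫) atTop (𝓝 (∫ y, ⟪u t y, a y⟫)) :=
    fun t ht a ha => hS'.tendsto_integral_inner_limit hν.le hu₀ hfm hf₂ hu hc ha ht
  -- signs and linear parts of the generators (`τ' = c τ c²` acts by `diag(sg ∘ (· + 1))`)
  set sg : Fin 3 → ℝ := ![1, -1, -1] with hsg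
  have hsg2 : ∀ i, sg i * sg i = 1 := by intro i; fin_cases i <;> simp [hsg]
  have hsgmul : ∀ i, sg i * sg (i + 1) = sg (i + 2) := by intro i; fin_cases i <;> simp [hsg]
  obtain ⟨D₁, hD₁⟩ := exists_signedShift sg 0
  obtain ⟨D₃, hD₃⟩ := exists_signedShift (fun i => sg (i + 1)) 0
  obtain ⟨Nn, hNn⟩ := exists_signedShift (fun _ => -1) 0
  obtain ⟨P₁, hP₁⟩ := exists_signedShift (fun _ => 1) 1
  obtain ⟨P₂, hP₂⟩ := exists_signedShift (fun _ => 1) 2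
  simp only [add_zero] at hD₁ hD₃ hNn; simp only [one_mul] at hP₁ hP₂
  -- pointwise covariance of the approximants
  have h3 : ∀ i : Fin 3, i + 1 + 1 + 1 = i := by decide
  have hPτ : ∀ n t, 0 ≤ t → ∀ y i, U (φ n) t (twistTurn y) i = sg i * U (φ n) t y i :=
    fun n t ht y => (twist_clause_iff _ _).1 ((hUsym _ _ ht).2.2 y)
  have hPτ' : ∀ n t, 0 ≤ t → ∀ y i,
      U (φ n) t (cycShift (twistTurn (cycShift (cycShift y)))) i = sg (i + 1) * U (φ n) t y i :=
    fun n t ht y i => by rw [(hUsym _ _ ht).1, hPτ n t ht, (hUsym _ _ ht).1, (hUsym _ _ ht).1, h3]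
  -- the `G`-average of the limit field: over `V = ⟨τ', τ⟩`, then `⟨c⟩`, then `⟨ι⟩`
  set w₁ : ℝ → 𝕋 → E3 := fun t y => (1 / 2 : ℝ) • (u t y + D₃ (u t (cycShift (twistTurn (cycShift (cycShift y))))))
  set w₂ : ℝ → 𝕋 → E3 := fun t y => (1 / 2 : ℝ) • (w₁ t y + D₁ (w₁ t (twistTurn y)))
  set w₃ : ℝ → 𝕋 → E3 := fun t y => (1 / 3 : ℝ) • (w₂ t y + P₂ (w₂ t (cycShift y)) + P₁ (w₂ t (cycShift (cycShift y))))
  set w₄ : ℝ → 𝕋 → E3 := fun t y => (1 / 2 : ℝ) • (w₃ t y + Nn (w₃ t (-y)))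
  -- covariance at every point
  have h1τ' : ∀ t y i, w₁ t (cycShift (twistTurn (cycShift (cycShift y)))) i = sg (i + 1) * w₁ t y i :=
    fun t => avg2_symm twistTurn'_twistTurn' (fun i => hsg2 _) hD₃ fun _ => rfl
  have h2τ : ∀ t y i, w₂ t (twistTurn y) i = sg i * w₂ t y i := fun t => avg2_symm twistTurn_twistTurn hsg2 hD₁ fun _ => rfl
  have h2τ' : ∀ t y i, w₂ t (cycShift (twistTurn (cycShift (cycShift y)))) i = sg (i + 1) * w₂ t y i :=
    fun t => avg2_keeps_diag twistTurn_comm hD₁ (fun _ => rfl) (h1τ' t)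
  have h2τ'' : ∀ t y i, w₂ t (cycShift (cycShift (twistTurn (cycShift y)))) i = sg (i + 2) * w₂ t y i :=
    fun t y i => by rw [twistTurn_conj, h2τ, h2τ', ← mul_assoc, hsgmul]
  have h3c : ∀ t y i, w₃ t (cycShift y) i = w₃ t y (i + 1) := fun t => avg3_symm cycShift_three hP₁ hP₂ fun _ => rfl
  have h3τ : ∀ t y i, w₃ t (twistTurn y) i = sg i * w₃ t y i :=
    fun t => avg3_keeps_diag cycShift_three hP₁ hP₂ (fun _ => rfl) (h2τ t) (h2τ' t) (h2τ'' t)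
  have h4ι : ∀ t y i, w₄ t (-y) i = -1 * w₄ t y i := fun t => avg2_symm neg_neg (fun _ => by norm_num) hNn fun _ => rfl
  have h4c : ∀ t y i, w₄ t (cycShift y) i = w₄ t y (i + 1) :=
    fun t => avg2_keeps_cyc (A := Neg.neg) (B := cycShift) (fun _ => rfl) hNn (fun _ => rfl) (h3c t)
  have h4τ : ∀ t y i, w₄ t (twistTurn y) i = sg i * w₄ t y i :=
    fun t => avg2_keeps_diag neg_twistTurn hNn (fun _ => rfl) (h3τ t)
  -- the average agrees a.e. with the limit slices, `t ≥ 0`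
  have hae4 : ∀ t, 0 ≤ t → w₄ t =ᵐ[volume] u t := by
    intro t ht
    have hv : ∀ n, MemLp (U (φ n) t) 2 volume := fun n => hS'.memLp_slice n ht
    have bτ' : ∀ᵐ y ∂volume, ∀ i, u t (cycShift (twistTurn (cycShift (cycShift y)))) i = sg (i + 1) * u t y i :=
      ae_all_iff.2 fun i => ae_symm_of_tendsto measurePreserving_twistTurn' measurePreserving_twistTurn'
        twistTurn'_twistTurn' hv (hu t ht) (hweak t ht) fun n y => hPτ' n t ht y i
    have bτ : ∀ᵐ y ∂volume, ∀ i, u t (twistTurn y) i = sg i * u t y i := ae_all_iff.2 fun i =>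
      ae_symm_of_tendsto measurePreserving_twistTurn measurePreserving_twistTurn
        twistTurn_twistTurn hv (hu t ht) (hweak t ht) fun n y => hPτ n t ht y i
    have bc : ∀ᵐ y ∂volume, ∀ i, u t (cycShift y) i = u t y (i + 1) :=
      (ae_all_iff.2 fun i => ae_symm_of_tendsto (c := 1) measurePreserving_cycShift
        (measurePreserving_cycShift.comp measurePreserving_cycShift) cycShift_three hv (hu t ht)
        (hweak t ht) fun n y => by rw [one_mul]; exact (hUsym _ _ ht).1 y i).mono
        fun y hy i => by rw [hy i, one_mul]
    have bι : ∀ᵐ y ∂volume, ∀ i, u t (-y) i = -1 * u t y i := ae_all_iff.2 fun i =>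
      ae_symm_of_tendsto measurePreserving_neg_torus measurePreserving_neg_torus neg_neg hv
        (hu t ht) (hweak t ht) fun n y => by rw [neg_one_mul]; exact (hUsym _ _ ht).2.1 y i
    have e1 : w₁ t =ᵐ[volume] u t := avg2_ae_eq (fun i => hsg2 _) hD₃ (fun _ => rfl) bτ'
    have e2 : w₂ t =ᵐ[volume] u t := (avg2_ae_eq hsg2 hD₁ (fun _ => rfl)
      (ae_transport measurePreserving_twistTurn e1 (fun a b => ∀ i, a i = sg i * b i) bτ)).trans e1
    have hc1 : ∀ᵐ y ∂volume, ∀ i, w₂ t (cycShift y) i = w₂ t y (i + 1) :=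
      ae_transport measurePreserving_cycShift e2 (fun a b => ∀ i, a i = b (i + 1)) bc
    have e3 : w₃ t =ᵐ[volume] u t :=
      (avg3_ae_eq hP₁ hP₂ (fun _ => rfl) hc1 (measurePreserving_cycShift.quasiMeasurePreserving.ae hc1)).trans e2
    exact (avg2_ae_eq (s := fun _ => -1) (fun _ => by norm_num) hNn (fun _ => rfl)
      (ae_transport measurePreserving_neg_torus e3 (fun a b => ∀ i, a i = -1 * b i) bι)).trans e3
  -- standing properties of the averaged field, and the limit lemmas
  have hu4 : ∀ t, 0 ≤ t → MemLp (w₄ t) 2 volume := fun t ht => (hu t ht).ae_eq (hae4 t ht).symm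
  have hc4 : ∀ t, 0 ≤ t → ∀ k, Tendsto (fun j => UnitAddTorus.mFourierCoeff (EuclideanSpace.complexify ∘ (U ∘ φ) j t) k)
      atTop (𝓝 (UnitAddTorus.mFourierCoeff (EuclideanSpace.complexify ∘ w₄ t) k)) := fun t ht k => by
    rw [Torus.mFourierCoeff_congr_ae ((hae4 t ht).fun_comp EuclideanSpace.complexify) k]; exact hc t ht k
  have hum4 : AEStronglyMeasurable (Torus.stLift w₄) (volume.restrict (Ioi 0 ×ˢ univ)) := by
    have m0 := Torus.aestronglyMeasurable_uncurry_of_stLift_prod hum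
    have m1 : AEStronglyMeasurable (uncurry w₁) ((volume.restrict (Ioi 0)).prod volume) :=
      (m0.add (aestronglyMeasurable_uncurry_comp m0 measurePreserving_twistTurn' D₃)).const_smul (1 / 2 : ℝ)
    have m2 : AEStronglyMeasurable (uncurry w₂) ((volume.restrict (Ioi 0)).prod volume) :=
      (m1.add (aestronglyMeasurable_uncurry_comp m1 measurePreserving_twistTurn D₁)).const_smul (1 / 2 : ℝ)
    have m3 : AEStronglyMeasurable (uncurry w₃) ((volume.restrict (Ioi 0)).prod volume) :=
      ((m2.add (aestronglyMeasurable_uncurry_comp m2 measurePreserving_cycShift P₂)).add (aestronglyMeasurable_uncurry_comp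
        m2 (measurePreserving_cycShift.comp measurePreserving_cycShift) P₁)).const_smul (1 / 3 : ℝ)
    exact Torus.aestronglyMeasurable_stLift_of_uncurry ((m3.add
      (aestronglyMeasurable_uncurry_comp m3 measurePreserving_neg_torus Nn)).const_smul (1 / 2 : ℝ))
  have hLH : Torus.IsGlobalLerayHopf ν (fun _ => gpForce) 0 w₄ := fun T hT =>
    hS'.isLerayHopfOn_limit hν hu₀ hdiv0 hfm hf₂ hum4 hu4 hc4 hT
  obtain ⟨U', hU'⟩ := exists_energySpace_lift_of_isGlobalLerayHopf_zero hfs hf0 hLH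
  refine ⟨w₄, U', hLH, hU', fun t _ => ⟨h4c t, fun y i => ?_, fun y => (twist_clause_iff _ _).2 (h4τ t y)⟩⟩
  rw [h4ι, neg_one_mul]

end Summit.AnomalousDissipation.AnomalousDissipation.Theorems.EnsembleRigidity.GPMeanBoundedFamily

end
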